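import Literature.Topology.FourManifolds.SeifertHypersurfaceLevel
import Literature.Topology.FourManifolds.GluckTwistSimplyConnected
import Literature.AlgebraicTopology.SingularHomology.MayerVietorisIsoRight
import Literature.AlgebraicTopology.SingularHomology.ExcisionMayerVietorisProofs
import Literature.AlgebraicTopology.SingularHomology.SimplyConnectedH1
import Literature.AlgebraicTopology.SingularHomology.HurewiczProofs
import Literature.AlgebraicTopology.SingularHomology.LoopClassesSpan
import Literature.AlgebraicTopology.FundamentalGroup.CircleAndTorus
import Mathlib.Analysis.SpecialFunctions.Complex.Arg
import HarnessLib

/-!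
# The linking homomorphism `π₁(Sⁿ⁺² ∖ M) → ℤ` of a framed codimension-two submanifold with
# simply connected core

Topic `Literature/Topology/FourManifolds`; fact seat
`provefact-Literature.Topology.FourManifolds.isOrientedBordant_of_isEmpty_of_signature_eq_zero`
(Kirby, *The Topology of 4-Manifolds* (1989), Cor. IX.2 via VIII Thm 1(A) and VIII Thm 3).  First
analytic input of Kirby's proof of VIII **Thm 3** (p. 45: *"Since `[N] = 0`, there is a class
`α ∈ H¹(Q − N; ℤ)` dual to the meridian … represented by `f_α : Q − N → S¹`"*) for `Q = Sⁿ⁺²`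
and a simply connected closed `N = M`, in the tree's vocabulary of framed tubular embeddings
(`Literature.Topology.FourManifolds.FramedTubularEmbedding n 2 M`): **there is a homomorphism
`φ : π₁(Sⁿ⁺² ∖ M, p₀) → ℤ` taking the value `1` on the meridian** (`exists_linkingHom`).
Everything here is **proved**; no named fact is introduced.

## The argument (Alexander duality in degree one, by Mayer–Vietoris)

Let `U = tube (M × ℝ²)` (open, `≅ M × ℝ²`, simply connected with `M`, so `H₁(U; ℤ) = 0`,
`isZero_singularHomology_one_of_simplyConnectedSpace`), `X = Sⁿ⁺² ∖ M` (open),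
`U ∩ X =` the punctured tube `P ≅ M × (ℝ² ∖ 0)`, `U ∪ X = Sⁿ⁺²`.  In the Mayer–Vietoris sequence
`H₂(Sⁿ⁺²) → H₁(P) → H₁(U) ⊕ H₁(X) → H₁(Sⁿ⁺²)` (the tree's `mayerVietoris.exact₁/₃_holds`) both
ends vanish for `n ≥ 1` (`isZero_singularHomology_sphere_holds`), so the inclusion induces an
isomorphism `H₁(P; ℤ) ≅ H₁(X; ℤ)` (`isIso_map_inter_of_isZero`).  The fibre angle
`P → ℝ/2πℤ`, `tube (x, w) ↦ arg w`, followed by the identification `H₁(ℝ/2πℤ; ℤ) ≅ π₁(ℝ/2πℤ) ≅ ℤ`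
(Hurewicz, Hatcher Thm. 2A.1, the tree's `hurewiczOne`, injective here because `π₁` of the
circle is commutative; and `fundamentalGroupAddCircleEquiv`, Hatcher Thm. 1.7) gives
`H₁(P; ℤ) → ℤ` with value `1` on the Hurewicz image of the meridian `t ↦ tube (x₀, e^{2πit})`;
composing with the inverse isomorphism and the Hurewicz map of `X` (natural, `hurewiczOne_map`)
yields `φ`.  Also proved here: **the complement `Sⁿ⁺² ∖ M` is path connected** for a connected
nonempty core (`pathConnectedSpace_embCompl`: the sphere is the union of the two open sets `X` and
`U` with connected intersection `P`).

## References

* R. C. Kirby, *The Topology of 4-Manifolds*, LNM 1374 (1989), Ch. VIII, proof of Thm. 3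
  (p. 45). [Kirby1989]
* A. Hatcher, *Algebraic Topology* (2002), Thm. 1.7, §2.2 (Mayer–Vietoris, p. 149), Thm. 2A.1,
  §3.3 Alexander duality. [HatcherAT2002]
-/

open scoped Manifold ContDiff Topology
open Function Set Filter CategoryTheory CategoryTheory.Limits
open Literature.AlgebraicTopology.SingularHomology Literature.AlgebraicTopology.FundamentalGroup

noncomputable section

namespace Literature.Topology.FourManifolds

/-- Local notation: `𝔼 n` is the model Euclidean space `EuclideanSpace ℝ (Fin n)`. -/
local notation "𝔼 " n:arg => EuclideanSpace ℝ (Fin n)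

/-- Local notation: `𝕊 n` is the unit sphere in `EuclideanSpace ℝ (Fin (n + 1))`. -/
local notation "𝕊 " n:arg => (Metric.sphere (0 : EuclideanSpace ℝ (Fin (n + 1))) 1)

-- `Fact (finrank ℝ ℝᵐ⁺¹ = m + 1)`, under which Mathlib charts the round spheres on `ℝᵐ`.
attribute [local instance] fact_finrank_euclideanSpace_succ

/-! ### A Mayer–Vietoris isomorphism criterion in degree one -/

section MayerVietoris

universe u

variable {S : Type u} [TopologicalSpace S]

/-- In a preadditive category the negative of an isomorphism is an isomorphism. [folklore] -/
theorem isIso_neg_of_isIso {C : Type*} [Category C] [Preadditive C] {A B : C} (f : A ⟶ B)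
    [IsIso f] : IsIso (-f) :=
  ⟨⟨-inv f, by rw [Preadditive.neg_comp_neg, IsIso.hom_inv_id],
    by rw [Preadditive.neg_comp_neg, IsIso.inv_hom_id]⟩⟩

/-- In a binary biproduct with zero first summand the second projection is an isomorphism.
[folklore] -/
theorem isIso_biprod_snd_of_isZero {C : Type*} [Category C] [Preadditive C] {A B : C}
    [HasBinaryBiproduct A B] (hA : IsZero A) : IsIso (biprod.snd : A ⊞ B ⟶ B) := by
  refine ⟨⟨biprod.inr, ?_, biprod.inr_snd⟩⟩
  refine biprod.hom_ext' _ _ ?_ ?_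
  · exact hA.eq_of_src _ _
  · rw [biprod.inr_snd_assoc, Category.comp_id]

/-- **Mayer–Vietoris isomorphism criterion in degree one (intersection piece).** Let
`S = U ∪ V` with `interior U ∪ interior V = S`, and suppose `H₁(S; ℤ) = 0`, `H₂(S; ℤ) = 0` and
`H₁(U; ℤ) = 0`. Then the inclusion `U ∩ V ↪ V` induces an isomorphism `H₁(U ∩ V; ℤ) ≅ H₁(V; ℤ)`:
in `H₂(S) ⟶δ H₁(U ∩ V) ⟶φ H₁(U) ⊞ H₁(V) ⟶ψ H₁(S)` both `δ` and `ψ` vanish, so `φ = (i_U, -i_V)`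
is an isomorphism (the tree's `mayerVietoris.exact₁_holds`, `exact₃_holds`), and so is the second
projection (`H₁(U) = 0`) (Hatcher 2002, §2.2 p. 149). [cite: HatcherAT2002, §2.2 p. 149] -/
theorem isIso_map_inter_of_isZero (U V : Set S) (hUV : interior U ∪ interior V = univ)
    (hS1 : IsZero (singularHomology ℤ ℤ S 1)) (hS2 : IsZero (singularHomology ℤ ℤ S 2))
    (hU : IsZero (singularHomology ℤ ℤ U 1)) :
    IsIso (singularHomology.map ℤ ℤ
      (subsetInclusion (inter_subset_right : U ∩ V ⊆ V)) 1) := by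
  have hexc := relativeSingularHomology.isIso_map_of_interior_union_interior_holds ℤ ℤ S
  -- `δ = 0`, hence `φ₁` is into
  have hδ : mayerVietoris.δ ℤ ℤ U V hexc hUV 1 = 0 := hS2.eq_of_src _ _
  haveI hmono : Mono (mayerVietoris.φ ℤ ℤ U V 1) :=
    (mayerVietoris.exact₃_holds ℤ ℤ U V hexc hUV 1).mono_g hδ
  -- `ψ = 0`, hence `φ₁` is onto
  have hψ : mayerVietoris.ψ ℤ ℤ U V 1 = 0 := hS1.eq_of_tgt _ _
  haveI hepi : Epi (mayerVietoris.φ ℤ ℤ U V 1) :=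
    (mayerVietoris.exact₁_holds ℤ ℤ U V hUV 1).epi_f hψ
  haveI : IsIso (mayerVietoris.φ ℤ ℤ U V 1) := isIso_of_mono_of_epi _
  haveI := isIso_biprod_snd_of_isZero (B := singularHomology ℤ ℤ V 1) hU
  -- `φ ≫ snd = -i_V`
  have hfac : mayerVietoris.φ ℤ ℤ U V 1 ≫ biprod.snd =
      -singularHomology.map ℤ ℤ (subsetInclusion (inter_subset_right : U ∩ V ⊆ V)) 1 :=
    biprod.lift_snd _ _
  haveI h1 : IsIso (-singularHomology.map ℤ ℤ
      (subsetInclusion (inter_subset_right : U ∩ V ⊆ V)) 1) := by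
    rw [← hfac]; infer_instance
  have h2 := isIso_neg_of_isIso (-singularHomology.map ℤ ℤ
      (subsetInclusion (inter_subset_right : U ∩ V ⊆ V)) 1)
  rwa [neg_neg] at h2

end MayerVietoris

/-! ### The winding functional on `H₁` of the circle `ℝ/pℤ` -/

section Circle

/-- On a group isomorphic to `ℤ` (commutative) the commutator subgroup is trivial. [folklore] -/
theorem commutator_eq_bot_of_mulEquiv_int {G : Type*} [Group G] (e : G ≃* Multiplicative ℤ) :
    commutator G = ⊥ := by
  rw [commutator_def, Subgroup.commutator_eq_bot_iff_le_centralizer]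
  intro a _
  rw [Subgroup.mem_centralizer_iff]
  intro b _
  apply e.injective
  rw [map_mul, map_mul, mul_comm]

/-- **The winding functional on `H₁(ℝ/pℤ; ℤ)`**: for `p ≠ 0` and every base point `a`, a
homomorphism `w : H₁(ℝ/pℤ; ℤ) → ℤ` (multiplicative notation) with `w (h[ω_a]) = 1` for the
Hurewicz class `h[ω_a]` of the winding loop `ω_a(t) = a + t·p` — the composite of the inverse of
the Hurewicz isomorphism `π₁(ℝ/pℤ, a) ≅ H₁(ℝ/pℤ; ℤ)` (Hatcher Thm. 2A.1, the tree's `hurewiczOne`: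
onto, kernel the commutator subgroup, trivial here) with `π₁(ℝ/pℤ, a) ≅ ℤ` (Hatcher Thm. 1.7, the
tree's `fundamentalGroupAddCircleEquiv`). [cite: HatcherAT2002, Thm. 1.7 and Thm. 2A.1] -/
theorem exists_windingHom_addCircle {p : ℝ} (hp : p ≠ 0) (a : AddCircle p) :
    ∃ w : Multiplicative (singularHomology ℤ ℤ (AddCircle p) 1) →* Multiplicative ℤ,
      w (hurewiczOne ℤ ℤ (1 : ℤ) a (FundamentalGroup.fromPath
        (Path.Homotopic.Quotient.mk (addCircleLoop p a)))) = Multiplicative.ofAdd 1 := by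
  haveI : Fact (0 < |p|) := ⟨abs_pos.2 hp⟩
  set eZ := fundamentalGroupAddCircleEquiv hp a with heZ
  set hur := hurewiczOne ℤ ℤ (1 : ℤ) a with hhur
  have hinj : Function.Injective hur := by
    rw [← MonoidHom.ker_eq_bot_iff, hhur, HurewiczProof.ker_hurewiczOne]
    exact commutator_eq_bot_of_mulEquiv_int eZ
  have hsurj : Function.Surjective hur := HurewiczProof.hurewiczOne_surjective a
  set eH := MulEquiv.ofBijective hur ⟨hinj, hsurj⟩ with heH
  refine ⟨eZ.toMonoidHom.comp eH.symm.toMonoidHom, ?_⟩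
  rw [MonoidHom.comp_apply, MulEquiv.coe_toMonoidHom, MulEquiv.coe_toMonoidHom]
  have : eH.symm (hur (FundamentalGroup.fromPath
      (Path.Homotopic.Quotient.mk (addCircleLoop p a)))) =
      FundamentalGroup.fromPath (Path.Homotopic.Quotient.mk (addCircleLoop p a)) := by
    rw [MulEquiv.symm_apply_eq]; rfl
  rw [this]
  exact fundamentalGroupAddCircleEquiv_addCircleLoop hp a

end Circle

/-! ### The plane as `ℂ` and the angle of a plane vector -/

namespace CodimTwo

/-- The plane vector `w ∈ ℝ²` as the complex number `w₀ + i w₁`. [folklore] -/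
def toCx (w : 𝔼 2) : ℂ := ⟨w 0, w 1⟩

/-- `toCx` is continuous. [folklore] -/
theorem continuous_toCx : Continuous toCx := by
  have h0 : Continuous fun w : 𝔼 2 => ((w 0 : ℝ) : ℂ) :=
    Complex.continuous_ofReal.comp (EuclideanSpace.proj (0 : Fin 2)).continuous
  have h1 : Continuous fun w : 𝔼 2 => ((w 1 : ℝ) : ℂ) :=
    Complex.continuous_ofReal.comp (EuclideanSpace.proj (1 : Fin 2)).continuous
  have h : Continuous fun w : 𝔼 2 => ((w 0 : ℝ) : ℂ) + ((w 1 : ℝ) : ℂ) * Complex.I :=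
    h0.add (h1.mul continuous_const)
  convert h using 1
  funext w
  apply Complex.ext <;> simp [toCx]

/-- `toCx w = 0 ↔ w = 0`. [folklore] -/
theorem toCx_eq_zero_iff (w : 𝔼 2) : toCx w = 0 ↔ w = 0 := by
  constructor
  · intro h
    have h0 : w 0 = 0 := by simpa [toCx] using congrArg Complex.re h
    have h1 : w 1 = 0 := by simpa [toCx] using congrArg Complex.im h
    ext i
    fin_cases i
    · exact h0
    · exact h1
  · rintro rfl
    rfl

/-- `toCx (cos θ, sin θ) = cos θ + i sin θ`. [folklore] -/
theorem toCx_circlePoint (θ : ℝ) :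
    toCx ((circlePoint θ : 𝕊 1) : 𝔼 2) = Real.cos θ + Real.sin θ * Complex.I := by
  apply Complex.ext <;>
    simp [toCx, Complex.cos_ofReal_re, Complex.sin_ofReal_re, Complex.cos_ofReal_im,
      Complex.sin_ofReal_im]

/-- **The angle of a plane vector** as a point of `ℝ/2πℤ` (`arg`, read in `Real.Angle`).
[folklore] -/
def planeAngle (w : 𝔼 2) : AddCircle (2 * Real.pi) := (Complex.arg (toCx w) : Real.Angle)

/-- The angle is continuous off the origin (`Complex.continuousAt_arg_coe_angle`: the jump of
`arg` across the negative real axis disappears in `ℝ/2πℤ`). [folklore] -/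
theorem continuousAt_planeAngle {w : 𝔼 2} (hw : w ≠ 0) : ContinuousAt planeAngle w :=
  (Complex.continuousAt_arg_coe_angle (mt (toCx_eq_zero_iff w).1 hw)).comp
    continuous_toCx.continuousAt

/-- The angle of `(cos θ, sin θ)` is `θ mod 2π`. [folklore] -/
theorem planeAngle_circlePoint (θ : ℝ) :
    planeAngle ((circlePoint θ : 𝕊 1) : 𝔼 2) = ((θ : ℝ) : AddCircle (2 * Real.pi)) := by
  rw [planeAngle, toCx_circlePoint]
  have h := Complex.arg_cos_add_sin_mul_I_coe_angle (θ : Real.Angle)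
  rw [Real.Angle.cos_coe, Real.Angle.sin_coe] at h
  exact h

end CodimTwo

open CodimTwo

/-! ### The punctured tube and the meridian of a framed codimension-two embedding -/

namespace FramedTubularEmbedding

variable {n : ℕ} {M : Type} [TopologicalSpace M] [ChartedSpace (𝔼 n) M]
  (E : FramedTubularEmbedding n 2 M)

/-- **The punctured tube** `tube (M × (ℝ² ∖ 0))`, as a subset of the sphere. [folklore] -/
def puncturedTube : Set (𝕊 (n + 2)) := E.tube '' {q | q.2 ≠ 0}

/-- The punctured tube is the tube off the core: `tube (M × (ℝ² ∖ 0)) = tube (M × ℝ²) ∩ (Sⁿ⁺² ∖ M)`.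
[folklore] -/
theorem range_tube_inter_compl_range_emb :
    range E.tube ∩ (range E.emb)ᶜ = E.puncturedTube := by
  ext p
  constructor
  · rintro ⟨⟨⟨x, w⟩, rfl⟩, hp⟩
    refine ⟨(x, w), fun hw => hp ?_, rfl⟩
    exact (E.tube_mem_range_emb_iff x w).2 hw
  · rintro ⟨⟨x, w⟩, hw, rfl⟩
    exact ⟨mem_range_self _, E.tube_not_mem_range_emb x hw⟩

/-- The punctured tube is open. [folklore] -/
theorem isOpen_puncturedTube : IsOpen E.puncturedTube :=
  E.isOpenEmbedding.isOpenMap _ ((isOpen_compl_singleton (x := (0 : 𝔼 2))).preimage continuous_snd)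

/-- `Sⁿ⁺² = tube (M × ℝ²) ∪ (Sⁿ⁺² ∖ M)`. [folklore] -/
theorem range_tube_union_compl_range_emb : range E.tube ∪ (range E.emb)ᶜ = univ := by
  refine eq_univ_of_forall fun p => ?_
  by_cases hp : p ∈ range E.emb
  · obtain ⟨x, rfl⟩ := hp
    exact Or.inl ⟨(x, 0), rfl⟩
  · exact Or.inr hp

/-- **The punctured tube is path connected** for a connected nonempty core (image of
`M × (ℝ² ∖ 0)`). [folklore] -/
theorem isPathConnected_puncturedTube [ConnectedSpace M] [Nonempty M] :
    IsPathConnected E.puncturedTube := by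
  haveI : LocallyPathConnectedSpace M := ChartedSpace.locallyPathConnectedSpace (𝔼 n) M
  haveI : PathConnectedSpace M := pathConnectedSpace_iff_connectedSpace.2 inferInstance
  have hM : IsPathConnected (univ : Set M) := pathConnectedSpace_iff_univ.1 inferInstance
  have hP : IsPathConnected ({0}ᶜ : Set (𝔼 2)) :=
    isPathConnected_compl_singleton_of_one_lt_rank
      (by rw [← Module.finrank_eq_rank, finrank_euclideanSpace_fin]; norm_num) 0
  have hprod : IsPathConnected ((univ : Set M) ×ˢ ({0}ᶜ : Set (𝔼 2))) := hM.prod hP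
  have heq : {q : M × 𝔼 2 | q.2 ≠ 0} = (univ : Set M) ×ˢ ({0}ᶜ : Set (𝔼 2)) := by
    ext q; simp
  rw [puncturedTube, heq]
  exact hprod.image E.continuous_tube

variable [CompactSpace M]

/-- **The complement `Sⁿ⁺² ∖ M` of the core is path connected** (connected nonempty `M`):
`Sⁿ⁺²` (connected for `n + 2 ≥ 2`) is the union of the open sets `Sⁿ⁺² ∖ M` and `tube (M × ℝ²)`
whose intersection, the punctured tube, is connected; so `Sⁿ⁺² ∖ M` is connected, and locally
path connected (general position in codimension two; Rolfsen, *Knots and Links*, §3).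
[folklore] -/
theorem isPathConnected_compl_range_emb [ConnectedSpace M] [Nonempty M] :
    IsPathConnected ((range E.emb)ᶜ : Set (𝕊 (n + 2))) := by
  haveI : PreconnectedSpace (𝕊 (n + 2)) := by
    have h : IsPreconnected (Metric.sphere (0 : 𝔼 (n + 2 + 1)) 1) := by
      apply isPreconnected_sphere
      rw [← Module.finrank_eq_rank, finrank_euclideanSpace_fin]
      exact_mod_cast (by omega : 1 < n + 2 + 1)
    exact isPreconnected_iff_preconnectedSpace.mp h
  haveI : LocallyPathConnectedSpace (𝕊 (n + 2)) :=
    ChartedSpace.locallyPathConnectedSpace (𝔼 (n + 2)) (𝕊 (n + 2))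
  have hUo : IsOpen ((range E.emb)ᶜ : Set (𝕊 (n + 2))) := E.isClosed_range_emb.isOpen_compl
  have hcov : (range E.emb)ᶜ ∪ range E.tube = univ := by
    rw [union_comm]; exact E.range_tube_union_compl_range_emb
  have hpre : IsPreconnected ((range E.emb)ᶜ : Set (𝕊 (n + 2))) := by
    refine IsPreconnected.of_isOpen_cover hUo E.isOpen_range hcov ?_
    rw [inter_comm, E.range_tube_inter_compl_range_emb]
    exact E.isPathConnected_puncturedTube.isConnected.isPreconnected
  obtain ⟨x₀⟩ := (inferInstance : Nonempty M)
  have hne : ((range E.emb)ᶜ : Set (𝕊 (n + 2))).Nonempty :=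
    ⟨_, E.tube_not_mem_range_emb x₀ (ne_zero_of_mem_unit_sphere (circlePoint 0))⟩
  exact hUo.isConnected_iff_isPathConnected.mp ⟨hne, hpre⟩

/-- The complement of the core, as a space, is path connected. [folklore] -/
theorem pathConnectedSpace_embCompl [ConnectedSpace M] [Nonempty M] :
    PathConnectedSpace E.embCompl :=
  isPathConnected_iff_pathConnectedSpace.mp E.isPathConnected_compl_range_emb

omit [CompactSpace M] in
/-- **The base point** `p₀ = tube (x₀, (1, 0))` on the unit normal circle over `x₀`. [folklore] -/
def basePt (x₀ : M) : 𝕊 (n + 2) := E.tube (x₀, ((circlePoint 0 : 𝕊 1) : 𝔼 2))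

omit [CompactSpace M] in
/-- The base point lies off the core. [folklore] -/
theorem basePt_not_mem (x₀ : M) : E.basePt x₀ ∉ range E.emb :=
  E.tube_not_mem_range_emb x₀ (ne_zero_of_mem_unit_sphere (circlePoint 0))

omit [CompactSpace M] in
/-- The meridian point at parameter `θ` returns to the base point after a full turn. [folklore] -/
theorem tube_circlePoint_two_pi (x₀ : M) :
    E.tube (x₀, ((circlePoint (2 * Real.pi * 1) : 𝕊 1) : 𝔼 2)) = E.basePt x₀ := by
  rw [mul_one, basePt, ← circlePoint_add_two_pi 0, zero_add]

omit [CompactSpace M] in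
/-- The meridian point at parameter `0` is the base point. [folklore] -/
theorem tube_circlePoint_zero (x₀ : M) :
    E.tube (x₀, ((circlePoint (2 * Real.pi * 0) : 𝕊 1) : 𝔼 2)) = E.basePt x₀ := by
  rw [mul_zero, basePt]

omit [CompactSpace M] in
/-- The meridian parametrisation `t ↦ tube (x₀, (cos 2πt, sin 2πt))` is continuous. [folklore] -/
theorem continuous_tube_circlePoint (x₀ : M) :
    Continuous fun t : unitInterval => E.tube (x₀, ((circlePoint (2 * Real.pi * t) : 𝕊 1) : 𝔼 2)) :=
  E.continuous_tube.comp (continuous_const.prodMk (continuous_subtype_val.comp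
    (continuous_circlePoint.comp (continuous_const.mul continuous_subtype_val))))

/-- The base point as a point of the complement of the core. [folklore] -/
def basePt' (x₀ : M) : E.embCompl := ⟨E.basePt x₀, E.basePt_not_mem x₀⟩

/-- **The meridian** of the core over `x₀`: the loop `t ↦ tube (x₀, (cos 2πt, sin 2πt))` in the
complement `Sⁿ⁺² ∖ M`, based at `p₀` (Kirby 1989, proof of VIII Thm. 3: "dual to the meridian";
Rolfsen, *Knots and Links*, §5.D). [cite: Kirby1989, Ch. VIII, proof of Thm. 3 (p. 45)] -/
def meridian (x₀ : M) : Path (E.basePt' x₀) (E.basePt' x₀) where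
  toFun t := ⟨E.tube (x₀, ((circlePoint (2 * Real.pi * t) : 𝕊 1) : 𝔼 2)),
    E.tube_not_mem_range_emb x₀ (ne_zero_of_mem_unit_sphere _)⟩
  continuous_toFun := (E.continuous_tube_circlePoint x₀).subtype_mk _
  source' := Subtype.ext (E.tube_circlePoint_zero x₀)
  target' := Subtype.ext (E.tube_circlePoint_two_pi x₀)

/-- Pointwise formula for the meridian. [folklore] -/
theorem meridian_apply_coe (x₀ : M) (t : unitInterval) :
    ((E.meridian x₀ t : E.embCompl) : 𝕊 (n + 2)) =
      E.tube (x₀, ((circlePoint (2 * Real.pi * t) : 𝕊 1) : 𝔼 2)) := rfl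

/-- The base point as a point of the punctured tube `tube (M × ℝ²) ∩ (Sⁿ⁺² ∖ M)`. [folklore] -/
def basePtInter (x₀ : M) : ↥(range E.tube ∩ (range E.emb)ᶜ) :=
  ⟨E.basePt x₀, mem_range_self _, E.basePt_not_mem x₀⟩

/-- The meridian as a loop in the punctured tube. [folklore] -/
def meridianInter (x₀ : M) : Path (E.basePtInter x₀) (E.basePtInter x₀) where
  toFun t := ⟨E.tube (x₀, ((circlePoint (2 * Real.pi * t) : 𝕊 1) : 𝔼 2)),
    mem_range_self _, E.tube_not_mem_range_emb x₀ (ne_zero_of_mem_unit_sphere _)⟩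
  continuous_toFun := (E.continuous_tube_circlePoint x₀).subtype_mk _
  source' := Subtype.ext (E.tube_circlePoint_zero x₀)
  target' := Subtype.ext (E.tube_circlePoint_two_pi x₀)

/-- The inclusion of the punctured tube in the complement of the core, as a continuous map.
[folklore] -/
def inclInter : C(↥(range E.tube ∩ (range E.emb)ᶜ), E.embCompl) :=
  ⟨fun q => ⟨q.1, q.2.2⟩, continuous_subtype_val.subtype_mk _⟩

/-- `inclInter` takes the base point to the base point (definitional). [folklore] -/
@[simp] theorem inclInter_basePtInter (x₀ : M) : E.inclInter (E.basePtInter x₀) = E.basePt' x₀ := rfl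

/-- The meridian in the complement is the image of the meridian in the punctured tube under the
inclusion. [folklore] -/
theorem meridianInter_map (x₀ : M) :
    (E.meridianInter x₀).map E.inclInter.continuous = E.meridian x₀ := by
  ext t
  rfl

/-! ### The linking homomorphism -/
set_option maxHeartbeats 400000 in -- buildfix (bf3-g27): 160k/180k FAIL, 200k PASS at accept time; line-neutral budget line
/-- **The linking homomorphism with the core** (Kirby 1989, proof of VIII Thm. 3: the class
`α ∈ H¹(Q − N; ℤ) = Hom(π₁, ℤ)` "dual to the meridian" of `N`, for `Q = Sⁿ⁺²`, `n ≥ 1`, and a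
connected, simply connected compact core `N = M` with a framed tubular neighbourhood): there is a
homomorphism `φ : π₁(Sⁿ⁺² ∖ M, p₀) → ℤ` with `φ [meridian] = 1`.  Proof: Alexander duality in
degree one by the Mayer–Vietoris sequence of `Sⁿ⁺² = tube ∪ (Sⁿ⁺² ∖ M)`
(`isIso_map_inter_of_isZero`: `H₁(punctured tube) ≅ H₁(Sⁿ⁺² ∖ M)`, using `H₁(tube) = 0` for the
simply connected tube `≅ M × ℝ²` and `H₁(Sⁿ⁺²) = H₂(Sⁿ⁺²) = 0`), the fibre angle
`punctured tube → ℝ/2πℤ`, the winding functional on `H₁(ℝ/2πℤ)` (`exists_windingHom_addCircle`)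
and the naturality of the Hurewicz map (`hurewiczOne_map`).
[cite: Kirby1989, Ch. VIII, proof of Thm. 3 (p. 45)] -/
theorem exists_linkingHom [ConnectedSpace M] [SimplyConnectedSpace M] (hn : 1 ≤ n) (x₀ : M) :
    ∃ φ : FundamentalGroup E.embCompl (E.basePt' x₀) →* Multiplicative ℤ,
      φ (FundamentalGroup.fromPath (Path.Homotopic.Quotient.mk (E.meridian x₀))) =
        Multiplicative.ofAdd 1 := by
  -- the two open pieces of the sphere and their intersection
  set U : Set (𝕊 (n + 2)) := range E.tube with hU
  set V : Set (𝕊 (n + 2)) := (range E.emb)ᶜ with hV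
  have hUo : IsOpen U := E.isOpen_range
  have hVo : IsOpen V := E.isClosed_range_emb.isOpen_compl
  have hUV : interior U ∪ interior V = univ := by
    rw [hUo.interior_eq, hVo.interior_eq]; exact E.range_tube_union_compl_range_emb
  -- `H₁(Sⁿ⁺²) = H₂(Sⁿ⁺²) = 0`
  have hS1 : IsZero (singularHomology ℤ ℤ (𝕊 (n + 2)) 1) :=
    isZero_singularHomology_sphere_holds ℤ ℤ one_ne_zero (by omega)
  have hS2 : IsZero (singularHomology ℤ ℤ (𝕊 (n + 2)) 2) :=
    isZero_singularHomology_sphere_holds ℤ ℤ two_ne_zero (by omega)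
  -- `H₁(U) = 0`: `U ≅ M × ℝ²` is simply connected
  haveI : SimplyConnectedSpace (M × 𝔼 2) := simplyConnectedSpace_prod
  haveI hUsc : SimplyConnectedSpace U :=
    (E.isOpenEmbedding.isEmbedding.toHomeomorph.toHomotopyEquiv.simplyConnectedSpace_iff).1
      inferInstance
  have hU1 : IsZero (singularHomology ℤ ℤ U 1) :=
    isZero_singularHomology_one_of_simplyConnectedSpace ℤ ℤ
  -- the Mayer–Vietoris isomorphism `H₁(U ∩ V) ≅ H₁(V)` (`V`, as a type, is `E.embCompl`)
  set i : C(↥(U ∩ V), E.embCompl) := E.inclInter with hi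
  haveI hiso : IsIso (singularHomology.map ℤ ℤ i 1) :=
    isIso_map_inter_of_isZero U V hUV hS1 hS2 hU1
  set eV := (asIso (singularHomology.map ℤ ℤ i 1)).toLinearEquiv with heV
  have heV_apply : ∀ y, eV y = singularHomology.map ℤ ℤ i 1 y := fun y => rfl
  -- the fibre angle on the punctured tube `U ∩ V`
  have hmemP : ∀ q : ↥(U ∩ V), E.fib q.1 ≠ 0 := by
    rintro ⟨q, hqU, hqV⟩ h0
    obtain ⟨⟨x, w⟩, rfl⟩ := hqU
    rw [E.fib_apply] at h0
    exact hqV ((E.tube_mem_range_emb_iff x w).2 h0)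
  have hang_cont : Continuous fun q : ↥(U ∩ V) => planeAngle (E.fib q.1) := by
    rw [continuous_iff_continuousAt]
    rintro ⟨q, hqU, hqV⟩
    have h1 : ContinuousAt E.fib q :=
      (E.contMDiffOn_fib.continuousOn.continuousWithinAt hqU).continuousAt (hUo.mem_nhds hqU)
    exact ((continuousAt_planeAngle (hmemP ⟨q, hqU, hqV⟩)).comp h1).comp
      continuous_subtype_val.continuousAt
  set ang : C(↥(U ∩ V), AddCircle (2 * Real.pi)) := ⟨fun q => planeAngle (E.fib q.1), hang_cont⟩
    with hang
  -- base points and the meridian inside `U ∩ V`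
  have hip₀ : i (E.basePtInter x₀) = E.basePt' x₀ := rfl
  set g₀ : FundamentalGroup (↥(U ∩ V)) (E.basePtInter x₀) :=
    FundamentalGroup.fromPath (Path.Homotopic.Quotient.mk (E.meridianInter x₀)) with hg₀
  have hmer : FundamentalGroup.fromPath (Path.Homotopic.Quotient.mk (E.meridian x₀)) =
      FundamentalGroup.map i (E.basePtInter x₀) g₀ := by
    rw [← E.meridianInter_map x₀]; rfl
  -- the angle of the base point and of the meridian
  set a₀ : AddCircle (2 * Real.pi) := ang (E.basePtInter x₀) with ha₀
  have ha₀0 : a₀ = 0 := by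
    show planeAngle (E.fib (E.basePt x₀)) = 0
    rw [basePt, E.fib_apply, planeAngle_circlePoint]
    simp
  have hangm : (E.meridianInter x₀).map ang.continuous = addCircleLoop (2 * Real.pi) a₀ := by
    ext t
    show planeAngle (E.fib (E.tube (x₀, ((circlePoint (2 * Real.pi * t) : 𝕊 1) : 𝔼 2)))) =
      a₀ + ((((t : ℝ) * (2 * Real.pi) : ℝ)) : AddCircle (2 * Real.pi))
    rw [E.fib_apply, planeAngle_circlePoint, ha₀0, zero_add, mul_comm (2 * Real.pi)]
  have hmap : FundamentalGroup.map ang (E.basePtInter x₀) g₀ =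
      FundamentalGroup.fromPath (Path.Homotopic.Quotient.mk (addCircleLoop (2 * Real.pi) a₀)) := by
    rw [← hangm]; rfl
  -- the winding functional on `H₁(ℝ/2πℤ)` at `a₀`
  have h2pi : (2 * Real.pi) ≠ 0 := by positivity
  obtain ⟨w, hw⟩ := exists_windingHom_addCircle h2pi a₀
  -- assemble `φ`
  set eInv : Multiplicative (singularHomology ℤ ℤ E.embCompl 1) →*
      Multiplicative (singularHomology ℤ ℤ ↥(U ∩ V) 1) :=
    AddMonoidHom.toMultiplicative eV.symm.toLinearMap.toAddMonoidHom with heInv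
  set hang1 : Multiplicative (singularHomology ℤ ℤ ↥(U ∩ V) 1) →*
      Multiplicative (singularHomology ℤ ℤ (AddCircle (2 * Real.pi)) 1) :=
    AddMonoidHom.toMultiplicative (singularHomology.map ℤ ℤ ang 1).hom.toAddMonoidHom with hhang1
  set φ := w.comp (hang1.comp (eInv.comp (hurewiczOne ℤ ℤ (1 : ℤ) (i (E.basePtInter x₀)))))
    with hφ
  -- evaluate on the meridian: naturality of the Hurewicz map along `i` …
  set y := hurewiczOne ℤ ℤ (1 : ℤ) (E.basePtInter x₀) g₀ with hy
  have hnat_i : hurewiczOne ℤ ℤ (1 : ℤ) (i (E.basePtInter x₀))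
      (FundamentalGroup.map i (E.basePtInter x₀) g₀) =
      Multiplicative.ofAdd (singularHomology.map ℤ ℤ i 1 (Multiplicative.toAdd y)) :=
    hurewiczOne_map (R := ℤ) ℤ (1 : ℤ) i (E.basePtInter x₀) g₀
  -- … undone by the inverse of the Mayer–Vietoris isomorphism …
  have hstep1 : eInv (Multiplicative.ofAdd (singularHomology.map ℤ ℤ i 1 (Multiplicative.toAdd y))) =
      y := by
    show Multiplicative.ofAdd (eV.symm (Multiplicative.toAdd (Multiplicative.ofAdd
      (singularHomology.map ℤ ℤ i 1 (Multiplicative.toAdd y))))) = y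
    rw [toAdd_ofAdd, ← heV_apply, LinearEquiv.symm_apply_apply, ofAdd_toAdd]
  -- … and naturality along the angle map
  have hstep2 : hang1 y = hurewiczOne ℤ ℤ (1 : ℤ) (ang (E.basePtInter x₀))
      (FundamentalGroup.map ang (E.basePtInter x₀) g₀) := by
    rw [hurewiczOne_map (R := ℤ) ℤ (1 : ℤ) ang (E.basePtInter x₀) g₀]
    rfl
  have key : φ (FundamentalGroup.map i (E.basePtInter x₀) g₀) = Multiplicative.ofAdd 1 := by
    rw [hφ, MonoidHom.comp_apply, MonoidHom.comp_apply, MonoidHom.comp_apply, hnat_i, hstep1,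
      hstep2, hmap]
    exact hw
  refine ⟨φ, ?_⟩
  rw [hmer]
  exact key

end FramedTubularEmbedding

end Literature.Topology.FourManifolds
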